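import Literature.Topology.FourManifolds.KhBigonStates
import HarnessLib

/-!
# A loop square in the cube of resolutions: the five sectors and the cancelling blocks

Sibling file of `KhComplex.lean`, abstracting from `KhBigonStates.lean` (second Reidemeister
move) the combinatorics shared with the third move (`KhTriangle.lean`): a **loop square** of a
Gauss diagram `K` is a pair of chords `f ≠ g`, a condition `P` on the states of the other
chords and a set `O` of arcs (the *small circle*) such that, over every state `σ` with
`σ f = 1, σ g = 0` and `P σ`, the arcs of `O` form one state circle by themselves, the flip of
`f` from `σ[f ↦ 0]` is a split and the flip of `g` from `σ` is a merge, exactly one local strand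
of `f` and one of `g` lying on `O` (`GaussDiagram.LoopSq`). The bigon of `Ω2` (with `P = ⊤`) and
the triangle of `Ω3` inside the layer `z = 1`, on both sides of the move, are loop squares.

For a loop square this file constructs, word for word as in `KhBigonStates.lean`:

* the `A`-sector `XA` (enhanced states over `σ f = σ g = 0`, `P σ`), the embeddings `embO x o`
  (sectors `P`: `o = X` and `Q`: `o = 1`, across the split at `f`) and `embU x` (sector `U`,
  across the merge at `g`), their left inverses `pullA`, `pullU`, and the bijection
  `loopESEquiv : XA ⊕ XA ⊕ XA ⊕ XA ⊕ XR ≃ K.EnhancedState` with the **rest** `XR` (enhanced states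
  over the other resolutions);
* the blocks of the incidence matrix used by the Gaussian elimination: `incidence_embA_embP`
  (`A → P` is a signed identity), `incidence_embQ_embU` (`Q → U` is a signed identity),
  `incidence_eq_zero_of_label_O_ne` (`Q → P` vanishes).

No named fact is introduced.

## References

* M. Khovanov, *A categorification of the Jones polynomial*, Duke Math. J. 101 (2000) 359–426,
  §5.3–§5.4. [cite: Khovanov2000, §5.3]
* D. Bar-Natan, *On Khovanov's categorification of the Jones polynomial*, Algebr. Geom. Topol. 2
  (2002) 337–370, §4.3–§4.4. [cite: BarNatan2002, §4]
-/

open CategoryTheory Function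

noncomputable section

namespace Literature.Topology.FourManifolds

namespace GaussDiagram

variable (K : GaussDiagram)

/-- **A loop square** of a Gauss diagram: two chords `f ≠ g`, a decidable condition `P` on
states invariant under changing `f` and `g`, and a decidable set `InO` of arcs such that over the
resolutions `σ f = 1, σ g = 0, P σ` the arcs of `InO` form one circle by themselves, the flip of
`f` into these resolutions is a split and the flip of `g` out of them is a merge, and exactly one
local strand of `f`, and one of `g`, lies on that circle. Khovanov (2000), §5.3–5.4;
Bar-Natan (2002), §4.3–4.4. [cite: Khovanov2000, §5.3] -/
structure LoopSq where
  /-- The chord flipped first (its flip splits off the small circle). -/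
  f : Fin K.n
  /-- The chord flipped second (its flip merges the small circle back). -/
  g : Fin K.n
  /-- The condition on the other chords. -/
  P : K.State → Prop
  /-- Membership in the small circle. -/
  InO : K.Arc → Prop
  /-- `P` is decidable. -/
  [decP : DecidablePred P]
  /-- `InO` is decidable. -/
  [decO : DecidablePred InO]
  /-- The two chords are distinct. -/
  f_ne_g : f ≠ g
  /-- `P` does not depend on `f`. -/
  P_update_f : ∀ σ b, P (Function.update σ f b) ↔ P σ
  /-- `P` does not depend on `g`. -/
  P_update_g : ∀ σ b, P (Function.update σ g b) ↔ P σ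
  /-- In the loop resolutions an arc on the circle of an arc of `O` is in `O`. -/
  closure : ∀ σ, σ f = true → σ g = false → P σ → ∀ u v, InO u →
    K.circleOf σ v = K.circleOf σ u → InO v
  /-- In the loop resolutions the arcs of `O` lie on one circle. -/
  connected : ∀ σ, σ f = true → σ g = false → P σ → ∀ u v, InO u → InO v →
    K.circleOf σ v = K.circleOf σ u
  /-- The flip of `f` into a loop resolution is a split. -/
  split : ∀ σ, σ f = false → σ g = false → P σ → K.IsSplitAt σ f
  /-- The flip of `g` out of a loop resolution is a merge. -/
  merge : ∀ σ, σ f = true → σ g = false → P σ → K.IsMergeAt σ g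
  /-- Exactly one local strand of `f` lies on the small circle. -/
  inO_aF_bF : (¬ InO (K.arcIn (K.overPos f)) ∧ InO (K.arcOut (K.overPos f))) ∨
    (InO (K.arcIn (K.overPos f)) ∧ ¬ InO (K.arcOut (K.overPos f)))
  /-- Exactly one local strand of `g` lies on the small circle. -/
  inO_aG_bG : (¬ InO (K.arcIn (K.overPos g)) ∧ InO (K.arcOut (K.overPos g))) ∨
    (InO (K.arcIn (K.overPos g)) ∧ ¬ InO (K.arcOut (K.overPos g)))
  /-- A chord other than `f, g` that can be flipped between two resolutions satisfying `P` does
  not enter its over-passage along the small circle. -/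
  not_inO_arcIn : ∀ (σ : K.State) (j : Fin K.n), P σ → P (Function.update σ j true) → σ j = false →
    j ≠ f → j ≠ g → ¬ InO (K.arcIn (K.overPos j))

/-- The condition of a loop square is decidable. [folklore] -/
instance LoopSq.instDecidablePredP {K : GaussDiagram} (L : K.LoopSq) : DecidablePred L.P := L.decP

/-- Membership in the small circle of a loop square is decidable. [folklore] -/
instance LoopSq.instDecidablePredInO {K : GaussDiagram} (L : K.LoopSq) : DecidablePred L.InO := L.decO

namespace LoopSq

variable {K} (L : K.LoopSq)

/-! ## The four resolutions of a loop square over a state of the other chords -/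

/-- The loop resolution over `σ`: `σ[f ↦ 1]`. [folklore] -/
def stO (σ : K.State) : K.State := Function.update σ L.f true

/-- The merged resolution over `σ`: `σ[f ↦ 1][g ↦ 1]`. [folklore] -/
def stU (σ : K.State) : K.State := Function.update (L.stO σ) L.g true

/-- The fourth resolution over `σ`: `σ[g ↦ 1]`. [folklore] -/
def stD (σ : K.State) : K.State := Function.update σ L.g true

/-- `stO σ` at `f`. [folklore] -/
@[simp] theorem stO_f (σ : K.State) : L.stO σ L.f = true := Function.update_self ..

/-- `stO σ` at `g`. [folklore] -/
@[simp] theorem stO_g (σ : K.State) : L.stO σ L.g = σ L.g := Function.update_of_ne L.f_ne_g.symm ..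

/-- `stO σ` elsewhere. [folklore] -/
theorem stO_of_ne (σ : K.State) {i : Fin K.n} (hi : i ≠ L.f) : L.stO σ i = σ i :=
  Function.update_of_ne hi ..

/-- `stU σ` at `f`. [folklore] -/
@[simp] theorem stU_f (σ : K.State) : L.stU σ L.f = true := by
  unfold stU; rw [Function.update_of_ne L.f_ne_g, stO_f]

/-- `stU σ` at `g`. [folklore] -/
@[simp] theorem stU_g (σ : K.State) : L.stU σ L.g = true := Function.update_self ..

/-- `stU σ` elsewhere. [folklore] -/
theorem stU_of_ne (σ : K.State) {i : Fin K.n} (hi : i ≠ L.f) (hi' : i ≠ L.g) : L.stU σ i = σ i := by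
  unfold stU; rw [Function.update_of_ne hi', L.stO_of_ne σ hi]

/-- States with the same loop resolution and the same value at `f` are equal. [folklore] -/
theorem eq_of_stO_eq {σ σ' : K.State} (h : L.stO σ = L.stO σ') (hf : σ L.f = σ' L.f) : σ = σ' := by
  funext i
  by_cases hi : i = L.f
  · rw [hi]; exact hf
  · have := congrFun h i
    rwa [L.stO_of_ne σ hi, L.stO_of_ne σ' hi] at this

/-- States with the same merged resolution and the same values at `f`, `g` are equal. [folklore] -/
theorem eq_of_stU_eq {σ σ' : K.State} (h : L.stU σ = L.stU σ') (hf : σ L.f = σ' L.f) (hg : σ L.g = σ' L.g) :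
    σ = σ' := by
  funext i
  by_cases hi : i = L.f
  · rw [hi]; exact hf
  by_cases hi' : i = L.g
  · rw [hi']; exact hg
  · have := congrFun h i
    rwa [L.stU_of_ne σ hi hi', L.stU_of_ne σ' hi hi'] at this

/-- `stD σ` at `f`. [folklore] -/
@[simp] theorem stD_f (σ : K.State) : L.stD σ L.f = σ L.f := Function.update_of_ne L.f_ne_g ..

/-- `stD σ` at `g`. [folklore] -/
@[simp] theorem stD_g (σ : K.State) : L.stD σ L.g = true := Function.update_self ..

/-- `P` holds at `stO σ` iff at `σ`. [folklore] -/
@[simp] theorem P_stO (σ : K.State) : L.P (L.stO σ) ↔ L.P σ := L.P_update_f σ true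

/-- `P` holds at `stU σ` iff at `σ`. [folklore] -/
@[simp] theorem P_stU (σ : K.State) : L.P (L.stU σ) ↔ L.P σ :=
  (L.P_update_g _ true).trans (L.P_update_f σ true)

/-- `P` holds at `stD σ` iff at `σ`. [folklore] -/
@[simp] theorem P_stD (σ : K.State) : L.P (L.stD σ) ↔ L.P σ := L.P_update_g σ true

/-- `stU` is `stD ∘ stO` and also `stO ∘ stD`. [folklore] -/
theorem update_stD_f (σ : K.State) : Function.update (L.stD σ) L.f true = L.stU σ := by
  unfold stU stD stO; exact Function.update_comm L.f_ne_g.symm _ _ _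

/-- A state with `f = 1` is `stO` of itself with `f` reset. [folklore] -/
theorem stO_update_false {τ : K.State} (h : τ L.f = true) : L.stO (Function.update τ L.f false) = τ := by
  unfold stO; rw [Function.update_idem, ← h, Function.update_eq_self]

/-- A state with `f = g = 1` is `stU` of itself with `f, g` reset. [folklore] -/
theorem stU_update_false {τ : K.State} (hf : τ L.f = true) (hg : τ L.g = true) :
    L.stU (Function.update (Function.update τ L.g false) L.f false) = τ := by
  unfold stU
  rw [L.stO_update_false (by rw [Function.update_of_ne L.f_ne_g]; exact hf), Function.update_idem,
    ← hg, Function.update_eq_self]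

/-! ## The local strands -/

/-- The strand of `f` entering its over-passage. [folklore] -/
def aF : K.Arc := K.arcIn (K.overPos L.f)
/-- The strand of `f` leaving its over-passage. [folklore] -/
def bF : K.Arc := K.arcOut (K.overPos L.f)
/-- The strand of `g` entering its over-passage. [folklore] -/
def aG : K.Arc := K.arcIn (K.overPos L.g)
/-- The strand of `g` leaving its over-passage. [folklore] -/
def bG : K.Arc := K.arcOut (K.overPos L.g)
/-- The strand of `f` off the small circle. [folklore] -/
def cF : K.Arc := if L.InO L.aF then L.bF else L.aF
/-- The strand of `g` off the small circle. [folklore] -/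
def cG : K.Arc := if L.InO L.aG then L.bG else L.aG

/-- Exactly one strand of `f` lies on the small circle. [folklore] -/
theorem inO_aF_bF' : (¬ L.InO L.aF ∧ L.InO L.bF) ∨ (L.InO L.aF ∧ ¬ L.InO L.bF) := L.inO_aF_bF

/-- Exactly one strand of `g` lies on the small circle. [folklore] -/
theorem inO_aG_bG' : (¬ L.InO L.aG ∧ L.InO L.bG) ∨ (L.InO L.aG ∧ ¬ L.InO L.bG) := L.inO_aG_bG

/-- `cF` is off the small circle. [folklore] -/
theorem not_inO_cF : ¬ L.InO L.cF := by
  unfold cF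
  rcases L.inO_aF_bF' with ⟨ha, hb⟩ | ⟨ha, hb⟩
  · rw [if_neg ha]; exact ha
  · rw [if_pos ha]; exact hb

/-- `cG` is off the small circle. [folklore] -/
theorem not_inO_cG : ¬ L.InO L.cG := by
  unfold cG
  rcases L.inO_aG_bG' with ⟨ha, hb⟩ | ⟨ha, hb⟩
  · rw [if_neg ha]; exact ha
  · rw [if_pos ha]; exact hb

/-! ## Circles in the four resolutions -/

section Circles

variable (σ : K.State) (hf : σ L.f = false) (hg : σ L.g = false) (hP : L.P σ)

include hg hP in
/-- In the loop resolution an arc on the circle of an arc of `O` is in `O`, and conversely.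
[folklore] -/
theorem circleOf_stO_eq_of_inO {u v : K.Arc} (hu : L.InO u) :
    K.circleOf (L.stO σ) v = K.circleOf (L.stO σ) u ↔ L.InO v :=
  ⟨L.closure _ (L.stO_f σ) (by rw [stO_g]; exact hg) ((L.P_stO σ).2 hP) u v hu,
    fun hv ↦ L.connected _ (L.stO_f σ) (by rw [stO_g]; exact hg) ((L.P_stO σ).2 hP) u v hu hv⟩

include hf hg hP in
/-- The flip of `f` from `σ` is a split. [folklore] -/
theorem isSplitAt : K.IsSplitAt σ L.f := L.split σ hf hg hP

include hg hP in
/-- The flip of `g` from `stO σ` is a merge. [folklore] -/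
theorem isMergeAt : K.IsMergeAt (L.stO σ) L.g :=
  L.merge _ (L.stO_f σ) (by rw [stO_g]; exact hg) ((L.P_stO σ).2 hP)

/-- `stO σ` is the flip of `f` from `σ`. [folklore] -/
theorem update_f : Function.update σ L.f true = L.stO σ := rfl

/-- `stU σ` is the flip of `g` from `stO σ`. [folklore] -/
theorem update_stO_g : Function.update (L.stO σ) L.g true = L.stU σ := rfl

include hf hg hP in
/-- Before the split the two local strands of `f` lie on one circle. [folklore] -/
theorem circleOf_stA_aF_eq_bF : K.circleOf σ L.aF = K.circleOf σ L.bF :=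
  circleOf_eq_iff.2 (L.isSplitAt σ hf hg hP).reachable

include hf hg hP in
/-- Circles of the loop resolution refine those before the split. [folklore] -/
theorem circleOf_stA_eq_of_stO_eq {u v : K.Arc}
    (h : K.circleOf (L.stO σ) u = K.circleOf (L.stO σ) v) : K.circleOf σ u = K.circleOf σ v := by
  rw [circleOf_eq_iff] at h ⊢
  exact (L.isSplitAt σ hf hg hP).reachable_of_reachable_update h

include hf hg hP in
/-- Before the split an arc of `O` lies on the circle of the strands of `f`. [folklore] -/
theorem circleOf_stA_eq_aF_of_inO {u : K.Arc} (hu : L.InO u) :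
    K.circleOf σ u = K.circleOf σ L.aF := by
  rcases L.inO_aF_bF' with ⟨-, hb⟩ | ⟨ha, -⟩
  · rw [L.circleOf_stA_aF_eq_bF σ hf hg hP]
    exact L.circleOf_stA_eq_of_stO_eq σ hf hg hP ((L.circleOf_stO_eq_of_inO σ hg hP hb).2 hu)
  · exact L.circleOf_stA_eq_of_stO_eq σ hf hg hP ((L.circleOf_stO_eq_of_inO σ hg hP ha).2 hu)

include hf hg hP in
/-- Before the split the strand `cF` lies on the circle of the strands of `f`. [folklore] -/
theorem circleOf_stA_cF : K.circleOf σ L.cF = K.circleOf σ L.aF := by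
  unfold cF; split_ifs
  · exact (L.circleOf_stA_aF_eq_bF σ hf hg hP).symm
  · rfl

include hg hP in
/-- Circles of the loop resolution are contained in circles of the merged one. [folklore] -/
theorem circleOf_stU_eq_of_stO_eq {u v : K.Arc}
    (h : K.circleOf (L.stO σ) u = K.circleOf (L.stO σ) v) :
    K.circleOf (L.stU σ) u = K.circleOf (L.stU σ) v := by
  rw [circleOf_eq_iff] at h ⊢
  exact (L.isMergeAt σ hg hP).reachable_update_of_reachable h

include hg hP in
/-- In the merged resolution the two strands of `g` lie on one circle. [folklore] -/
theorem circleOf_stU_aG_eq_bG : K.circleOf (L.stU σ) L.aG = K.circleOf (L.stU σ) L.bG := by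
  rw [circleOf_eq_iff]
  exact (L.isMergeAt σ hg hP).reachable_update

include hg hP in
/-- In the merged resolution an arc of `O` lies on the merged circle. [folklore] -/
theorem circleOf_stU_eq_aG_of_inO {u : K.Arc} (hu : L.InO u) :
    K.circleOf (L.stU σ) u = K.circleOf (L.stU σ) L.aG := by
  rcases L.inO_aG_bG' with ⟨-, hb⟩ | ⟨ha, -⟩
  · rw [L.circleOf_stU_aG_eq_bG σ hg hP]
    exact L.circleOf_stU_eq_of_stO_eq σ hg hP ((L.circleOf_stO_eq_of_inO σ hg hP hb).2 hu)
  · exact L.circleOf_stU_eq_of_stO_eq σ hg hP ((L.circleOf_stO_eq_of_inO σ hg hP ha).2 hu)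

include hg hP in
/-- In the merged resolution `cG` lies on the merged circle. [folklore] -/
theorem circleOf_stU_cG : K.circleOf (L.stU σ) L.cG = K.circleOf (L.stU σ) L.aG := by
  unfold cG; split_ifs
  · exact (L.circleOf_stU_aG_eq_bG σ hg hP).symm
  · rfl

include hg hP in
/-- In the loop resolution an arc on the circle of `cG` is off the small circle. [folklore] -/
theorem not_inO_of_circleOf_stO_eq_cG {u : K.Arc}
    (h : K.circleOf (L.stO σ) u = K.circleOf (L.stO σ) L.cG) : ¬ L.InO u := fun hu ↦
  L.not_inO_cG ((L.circleOf_stO_eq_of_inO σ hg hP hu).1 h.symm)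

end Circles


/-! ## The `A`-sector and the embeddings of the sectors `P`, `Q`, `U` -/

/-- **The `A`-sector** of a loop square: the enhanced states over the resolutions
`σ f = σ g = 0`, `P σ`. Khovanov (2000), §5.3. [cite: Khovanov2000, §5.3] -/
def XA : Type :=
  {t : K.EnhancedState // t.state L.f = false ∧ t.state L.g = false ∧ L.P t.state}

/-- The `A`-sector is a finite type. [folklore] -/
instance instFintypeXA : Fintype L.XA := by unfold XA; infer_instance
/-- The `A`-sector has decidable equality. [folklore] -/
instance instDecidableEqXA : DecidableEq L.XA := by unfold XA; infer_instance

/-- **The rest**: the enhanced states over the resolutions not in the sectors `A`, `P ∪ Q`, `U`,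
that is with `¬ P σ`, or with `σ f = 0, σ g = 1`. [folklore] -/
def XR : Type :=
  {t : K.EnhancedState // ¬ (L.P t.state ∧ (t.state L.f = false → t.state L.g = false))}

/-- The rest is a finite type. [folklore] -/
instance instFintypeXR : Fintype L.XR := by unfold XR; infer_instance
/-- The rest has decidable equality. [folklore] -/
instance instDecidableEqXR : DecidableEq L.XR := by unfold XR; infer_instance

variable {L}

/-- Two arcs of the small circle carry the same label in an enhanced state over a loop
resolution. [folklore] -/
theorem label_eq_of_inO {t : K.EnhancedState} {σ : K.State} (ht : t.state = L.stO σ)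
    (hg : σ L.g = false) (hP : L.P σ) {u v : K.Arc} (hu : L.InO u) (hv : L.InO v) :
    t.label u = t.label v :=
  t.label_eq_of_circleOf_eq (by rw [ht]; exact ((L.circleOf_stO_eq_of_inO σ hg hP hv).2 hu))

/-- **The sectors `P` (`o = X`) and `Q` (`o = 1`)**: push an element of the `A`-sector across the
split at `f`, labelling the small circle by `o`. Khovanov (2000), §5.3. [cite: Khovanov2000, §5.3] -/
def embO (x : L.XA) (o : Bool) : K.EnhancedState :=
  (L.isSplitAt x.1.state x.2.1 x.2.2.1 x.2.2.2).push (x.1.lab rfl)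
    (if L.InO L.aF then o else x.1.label L.aF)
    (if L.InO L.aF then x.1.label L.aF else o)

/-- The state of `embO x o`. [folklore] -/
@[simp] theorem embO_state (x : L.XA) (o : Bool) : (embO x o).state = L.stO x.1.state := by
  unfold embO; rw [IsSplitAt.push_state]; rfl

/-- **`embO x o` labels the small circle by `o`.** [folklore] -/
theorem embO_label_of_inO (x : L.XA) (o : Bool) {u : K.Arc} (hu : L.InO u) : (embO x o).label u = o := by
  unfold embO
  rw [IsSplitAt.push_label, update_f]
  rcases L.inO_aF_bF' with ⟨ha, hb⟩ | ⟨ha, hb⟩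
  · rw [if_neg ha, if_neg ha, if_neg, if_pos]
    · exact (L.circleOf_stO_eq_of_inO _ x.2.2.1 x.2.2.2 hb).2 hu
    · exact fun h ↦ ha ((L.circleOf_stO_eq_of_inO _ x.2.2.1 x.2.2.2 hu).1 h.symm)
  · rw [if_pos ha, if_pos]
    exact (L.circleOf_stO_eq_of_inO _ x.2.2.1 x.2.2.2 ha).2 hu

/-- **`embO x o` has the labels of `x` off the small circle.** [folklore] -/
theorem embO_label_of_not_inO (x : L.XA) (o : Bool) {u : K.Arc} (hu : ¬ L.InO u) :
    (embO x o).label u = x.1.label u := by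
  unfold embO
  rw [IsSplitAt.push_label, update_f]
  simp only [EnhancedState.lab_val]
  set σ := x.1.state
  have lab : ∀ w : K.Arc, K.circleOf (L.stO σ) u = K.circleOf (L.stO σ) w → (w = L.aF ∨ w = L.bF) →
      x.1.label L.aF = x.1.label u := by
    intro w hw hw'
    apply x.1.label_eq_of_circleOf_eq
    have h1 := L.circleOf_stA_eq_of_stO_eq σ x.2.1 x.2.2.1 x.2.2.2 hw
    rcases hw' with rfl | rfl
    · exact h1.symm
    · rw [h1, L.circleOf_stA_aF_eq_bF σ x.2.1 x.2.2.1 x.2.2.2]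
  rcases L.inO_aF_bF' with ⟨ha, hb⟩ | ⟨ha, hb⟩
  · rw [if_neg ha, if_neg ha]
    split_ifs with h1 h2
    · exact lab _ h1 (Or.inl rfl)
    · exact (hu ((L.circleOf_stO_eq_of_inO σ x.2.2.1 x.2.2.2 hb).1 h2)).elim
    · rfl
  · rw [if_pos ha, if_pos ha]
    split_ifs with h1 h2
    · exact (hu ((L.circleOf_stO_eq_of_inO σ x.2.2.1 x.2.2.2 ha).1 h1)).elim
    · exact lab _ h2 (Or.inr rfl)
    · rfl

/-- `embO x o` determines `x`. [folklore] -/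
theorem embO_injective (o : Bool) : Injective (fun x : L.XA ↦ embO x o) := by
  intro x x' h
  dsimp only at h
  have hσ : x.1.state = x'.1.state := by
    have := congrArg EnhancedState.state h
    rw [embO_state, embO_state] at this
    exact L.eq_of_stO_eq this (by rw [x.2.1, x'.2.1])
  apply Subtype.ext
  refine EnhancedState.ext' hσ (funext fun u ↦ ?_)
  by_cases hu : L.InO u
  · have e1 : x.1.label u = x.1.label L.cF := x.1.label_eq_of_circleOf_eq (by
      rw [L.circleOf_stA_cF _ x.2.1 x.2.2.1 x.2.2.2]
      exact L.circleOf_stA_eq_aF_of_inO _ x.2.1 x.2.2.1 x.2.2.2 hu)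
    have e2 : x'.1.label u = x'.1.label L.cF := x'.1.label_eq_of_circleOf_eq (by
      rw [L.circleOf_stA_cF _ x'.2.1 x'.2.2.1 x'.2.2.2]
      exact L.circleOf_stA_eq_aF_of_inO _ x'.2.1 x'.2.2.1 x'.2.2.2 hu)
    rw [e1, e2, ← embO_label_of_not_inO x o L.not_inO_cF, ← embO_label_of_not_inO x' o L.not_inO_cF, h]
  · rw [← embO_label_of_not_inO x o hu, ← embO_label_of_not_inO x' o hu, h]

/-- **The sector `U`**: push `embO x 1` across the merge at `g`, the merged circle taking the
label of the strand of `g` off the small circle. Khovanov (2000), §5.3. [cite: Khovanov2000, §5.3] -/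
def embU (x : L.XA) : K.EnhancedState :=
  (L.isMergeAt x.1.state x.2.2.1 x.2.2.2).push ((embO x false).lab (embO_state x false)) (x.1.label L.cG)

/-- The state of `embU x`. [folklore] -/
@[simp] theorem embU_state (x : L.XA) : (embU x).state = L.stU x.1.state := by
  unfold embU; rw [IsMergeAt.push_state]; rfl

/-- The labels of `embU x`. [folklore] -/
theorem embU_label (x : L.XA) (u : K.Arc) :
    (embU x).label u =
      if K.circleOf (L.stU x.1.state) u = K.circleOf (L.stU x.1.state) L.aG
      then x.1.label L.cG else (embO x false).label u := by
  unfold embU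
  rw [IsMergeAt.push_label]
  rfl

/-- **Off the small circle `embU x` has the labels of `x`.** [folklore] -/
theorem embU_label_of_not_inO (x : L.XA) {u : K.Arc} (hu : ¬ L.InO u) : (embU x).label u = x.1.label u := by
  rw [embU_label]
  split_ifs with h
  · set σ := x.1.state
    apply x.1.label_eq_of_circleOf_eq
    apply L.circleOf_stA_eq_of_stO_eq σ x.2.1 x.2.2.1 x.2.2.2
    rw [circleOf_eq_iff] at h ⊢
    have key := (L.isMergeAt σ x.2.2.1 x.2.2.2).reachable_update_iff u L.aG
    rw [update_stO_g] at key
    rw [key] at h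
    have hcG : ∀ w, (w = L.aG ∨ w = L.bG) → (K.stateGraph (L.stO σ)).Reachable u w →
        (K.stateGraph (L.stO σ)).Reachable L.cG w := by
      intro w hw huw
      unfold cG
      rcases L.inO_aG_bG' with ⟨ha, hb⟩ | ⟨ha, hb⟩
      · rw [if_neg ha]
        rcases hw with rfl | rfl
        · rfl
        · exact (hu ((L.circleOf_stO_eq_of_inO σ x.2.2.1 x.2.2.2 hb).1 (circleOf_eq_iff.2 huw))).elim
      · rw [if_pos ha]
        rcases hw with rfl | rfl
        · exact (hu ((L.circleOf_stO_eq_of_inO σ x.2.2.1 x.2.2.2 ha).1 (circleOf_eq_iff.2 huw))).elim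
        · rfl
    rcases h with h | ⟨h, -⟩ | ⟨h, -⟩
    · exact (h.trans (hcG _ (Or.inl rfl) h).symm).symm
    · exact (h.trans (hcG _ (Or.inl rfl) h).symm).symm
    · exact (h.trans (hcG _ (Or.inr rfl) h).symm).symm
  · exact embO_label_of_not_inO x false hu

/-- **On the small circle `embU x` has the label of `x` at `cG`.** [folklore] -/
theorem embU_label_of_inO (x : L.XA) {u : K.Arc} (hu : L.InO u) : (embU x).label u = x.1.label L.cG := by
  rw [embU_label, if_pos (L.circleOf_stU_eq_aG_of_inO _ x.2.2.1 x.2.2.2 hu)]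

/-- The label of `embU x` at the first strand of `g`. [folklore] -/
theorem embU_label_aG (x : L.XA) : (embU x).label L.aG = x.1.label L.cG := by
  rw [embU_label, if_pos rfl]

/-- `embU` is injective. [folklore] -/
theorem embU_injective : Injective (embU (L := L)) := by
  intro x x' h
  have hσ : x.1.state = x'.1.state := by
    have := congrArg EnhancedState.state h
    rw [embU_state, embU_state] at this
    exact L.eq_of_stU_eq this (by rw [x.2.1, x'.2.1]) (by rw [x.2.2.1, x'.2.2.1])
  apply Subtype.ext
  refine EnhancedState.ext' hσ (funext fun u ↦ ?_)
  by_cases hu : L.InO u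
  · have e1 : x.1.label u = x.1.label L.cF := x.1.label_eq_of_circleOf_eq (by
      rw [L.circleOf_stA_cF _ x.2.1 x.2.2.1 x.2.2.2]
      exact L.circleOf_stA_eq_aF_of_inO _ x.2.1 x.2.2.1 x.2.2.2 hu)
    have e2 : x'.1.label u = x'.1.label L.cF := x'.1.label_eq_of_circleOf_eq (by
      rw [L.circleOf_stA_cF _ x'.2.1 x'.2.2.1 x'.2.2.2]
      exact L.circleOf_stA_eq_aF_of_inO _ x'.2.1 x'.2.2.1 x'.2.2.2 hu)
    rw [e1, e2, ← embU_label_of_not_inO x L.not_inO_cF, ← embU_label_of_not_inO x' L.not_inO_cF, h]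
  · rw [← embU_label_of_not_inO x hu, ← embU_label_of_not_inO x' hu, h]

/-! ## Pulling back to the `A`-sector -/

/-- The `A`-state under an enhanced state over a loop resolution. [folklore] -/
theorem stO_of_state {t : K.EnhancedState} (ht : t.state L.f = true) :
    L.stO (Function.update t.state L.f false) = t.state := L.stO_update_false ht

/-- **Pull an enhanced state over a loop resolution back to the `A`-sector** (the split circle
takes the label of the strand of `f` off the small circle). [folklore] -/
def pullA (t : K.EnhancedState) (ht : t.state L.f = true ∧ t.state L.g = false ∧ L.P t.state) : L.XA :=
  ⟨(L.isSplitAt (Function.update t.state L.f false) (Function.update_self ..)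
      (by rw [Function.update_of_ne L.f_ne_g.symm]; exact ht.2.1) ((L.P_update_f _ _).2 ht.2.2)).pull
      (t.lab (stO_of_state ht.1).symm) (t.label L.cF),
    by
      simp only [IsSplitAt.pull_state]
      exact ⟨Function.update_self .., by rw [Function.update_of_ne L.f_ne_g.symm]; exact ht.2.1,
        (L.P_update_f _ _).2 ht.2.2⟩⟩

/-- The state of `pullA t`. [folklore] -/
@[simp] theorem pullA_state (t : K.EnhancedState) (ht : t.state L.f = true ∧ t.state L.g = false ∧ L.P t.state) :
    (pullA t ht).1.state = Function.update t.state L.f false := rfl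

/-- **`pullA t` has the labels of `t` off the small circle.** [folklore] -/
theorem pullA_label_of_not_inO (t : K.EnhancedState)
    (ht : t.state L.f = true ∧ t.state L.g = false ∧ L.P t.state) {u : K.Arc} (hu : ¬ L.InO u) :
    (pullA t ht).1.label u = t.label u := by
  set σ := Function.update t.state L.f false with hσ
  have hf : σ L.f = false := Function.update_self ..
  have hg : σ L.g = false := by rw [hσ, Function.update_of_ne L.f_ne_g.symm]; exact ht.2.1
  have hP : L.P σ := (L.P_update_f _ _).2 ht.2.2
  have hst : t.state = L.stO σ := (stO_of_state ht.1).symm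
  show ((L.isSplitAt σ hf hg hP).pull _ _).label u = _
  rw [IsSplitAt.pull_label]
  split_ifs with h
  · apply t.label_eq_of_circleOf_eq
    rw [hst]
    rw [circleOf_eq_iff]
    rw [circleOf_eq_iff] at h
    have key := ((L.isSplitAt σ hf hg hP).reachable_iff u L.aF).1 h
    have hcF : ∀ w, (w = L.aF ∨ w = L.bF) → (K.stateGraph (L.stO σ)).Reachable u w →
        (K.stateGraph (L.stO σ)).Reachable L.cF w := by
      intro w hw huw
      unfold cF
      rcases L.inO_aF_bF' with ⟨ha, hb⟩ | ⟨ha, hb⟩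
      · rw [if_neg ha]
        rcases hw with rfl | rfl
        · rfl
        · exact (hu ((L.circleOf_stO_eq_of_inO σ hg hP hb).1 (circleOf_eq_iff.2 huw))).elim
      · rw [if_pos ha]
        rcases hw with rfl | rfl
        · exact (hu ((L.circleOf_stO_eq_of_inO σ hg hP ha).1 (circleOf_eq_iff.2 huw))).elim
        · rfl
    rcases key with h | ⟨h, -⟩ | ⟨h, -⟩
    · exact (h.trans (hcF _ (Or.inl rfl) h).symm).symm
    · exact (h.trans (hcF _ (Or.inl rfl) h).symm).symm
    · exact (h.trans (hcF _ (Or.inr rfl) h).symm).symm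
  · rfl

/-- **`pullA t` has the label of `t` at `cF` on the small circle.** [folklore] -/
theorem pullA_label_of_inO (t : K.EnhancedState)
    (ht : t.state L.f = true ∧ t.state L.g = false ∧ L.P t.state) {u : K.Arc} (hu : L.InO u) :
    (pullA t ht).1.label u = t.label L.cF := by
  set σ := Function.update t.state L.f false with hσ
  have hf : σ L.f = false := Function.update_self ..
  have hg : σ L.g = false := by rw [hσ, Function.update_of_ne L.f_ne_g.symm]; exact ht.2.1
  have hP : L.P σ := (L.P_update_f _ _).2 ht.2.2
  show ((L.isSplitAt σ hf hg hP).pull _ _).label u = _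
  rw [IsSplitAt.pull_label]
  exact if_pos (L.circleOf_stA_eq_aF_of_inO _ hf hg hP hu)

variable (o₀ : K.Arc) (ho₀ : L.InO o₀)

include ho₀ in
/-- **Push after pull**: an enhanced state over a loop resolution is `embO` of its pull-back,
with its own label on the small circle (read at any arc `o₀` of it). [folklore] -/
theorem embO_pullA (t : K.EnhancedState) (ht : t.state L.f = true ∧ t.state L.g = false ∧ L.P t.state) :
    embO (pullA t ht) (t.label o₀) = t := by
  have hst : t.state = L.stO (Function.update t.state L.f false) := (stO_of_state ht.1).symm
  refine EnhancedState.ext' (by rw [embO_state, pullA_state, ← hst]) (funext fun u ↦ ?_)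
  by_cases hu : L.InO u
  · rw [embO_label_of_inO _ _ hu]
    exact label_eq_of_inO hst (by rw [Function.update_of_ne L.f_ne_g.symm]; exact ht.2.1)
      ((L.P_update_f _ _).2 ht.2.2) ho₀ hu
  · rw [embO_label_of_not_inO _ _ hu, pullA_label_of_not_inO t ht hu]

/-- **Pull after push**: `pullA (embO x o) = x`. [folklore] -/
theorem pullA_embO (x : L.XA) (o : Bool)
    (h : (embO x o).state L.f = true ∧ (embO x o).state L.g = false ∧ L.P (embO x o).state) :
    pullA (embO x o) h = x := by
  apply Subtype.ext
  refine EnhancedState.ext' ?_ (funext fun u ↦ ?_)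
  · rw [pullA_state, embO_state]
    unfold stO
    rw [Function.update_idem]
    exact Function.update_eq_self_iff.2 x.2.1.symm
  · by_cases hu : L.InO u
    · rw [pullA_label_of_inO _ h hu, embO_label_of_not_inO x o L.not_inO_cF]
      apply x.1.label_eq_of_circleOf_eq
      rw [L.circleOf_stA_cF _ x.2.1 x.2.2.1 x.2.2.2]
      exact (L.circleOf_stA_eq_aF_of_inO _ x.2.1 x.2.2.1 x.2.2.2 hu).symm
    · rw [pullA_label_of_not_inO _ h hu, embO_label_of_not_inO x o hu]

/-- The sector conditions of a pushed state. [folklore] -/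
theorem embO_cond (x : L.XA) (o : Bool) :
    (embO x o).state L.f = true ∧ (embO x o).state L.g = false ∧ L.P (embO x o).state := by
  rw [embO_state]
  exact ⟨L.stO_f _, by rw [stO_g]; exact x.2.2.1, (L.P_stO _).2 x.2.2.2⟩

/-- **Pull an enhanced state over a merged resolution back to the loop resolution**, the small
circle labelled `1` and the other circle through the strands of `g` keeping its label. [folklore] -/
def pullU (t : K.EnhancedState) (ht : t.state L.f = true ∧ t.state L.g = true ∧ L.P t.state) :
    K.EnhancedState :=
  (L.isMergeAt (Function.update (Function.update t.state L.g false) L.f false)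
      (by rw [Function.update_of_ne L.f_ne_g.symm, Function.update_self])
      ((L.P_update_f _ _).2 ((L.P_update_g _ _).2 ht.2.2))).pull
    (t.lab (by rw [update_stO_g, L.stU_update_false ht.1 ht.2.1]))
    (if L.InO L.aG then false else t.label L.aG) (if L.InO L.aG then t.label L.aG else false)

/-- The state of `pullU t`. [folklore] -/
@[simp] theorem pullU_state (t : K.EnhancedState) (ht : t.state L.f = true ∧ t.state L.g = true ∧ L.P t.state) :
    (pullU t ht).state = L.stO (Function.update (Function.update t.state L.g false) L.f false) := rfl

/-- The `A`-state under an enhanced state over a merged resolution. [folklore] -/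
theorem cond_of_stU {t : K.EnhancedState} (ht : t.state L.f = true ∧ t.state L.g = true ∧ L.P t.state) :
    Function.update (Function.update t.state L.g false) L.f false L.f = false ∧
      Function.update (Function.update t.state L.g false) L.f false L.g = false ∧
        L.P (Function.update (Function.update t.state L.g false) L.f false) :=
  ⟨Function.update_self .., by rw [Function.update_of_ne L.f_ne_g.symm, Function.update_self],
    (L.P_update_f _ _).2 ((L.P_update_g _ _).2 ht.2.2)⟩

/-- **`pullU t` labels the small circle `1`.** [folklore] -/
theorem pullU_label_of_inO (t : K.EnhancedState)
    (ht : t.state L.f = true ∧ t.state L.g = true ∧ L.P t.state) {u : K.Arc} (hu : L.InO u) :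
    (pullU t ht).label u = false := by
  obtain ⟨hf, hg, hP⟩ := cond_of_stU ht
  show ((L.isMergeAt _ hg hP).pull _ _ _).label u = _
  rw [IsMergeAt.pull_label]
  rcases L.inO_aG_bG' with ⟨ha, hb⟩ | ⟨ha, hb⟩
  · rw [if_neg ha, if_neg ha, if_neg, if_pos]
    · exact (L.circleOf_stO_eq_of_inO _ hg hP hb).2 hu
    · exact fun h ↦ ha ((L.circleOf_stO_eq_of_inO _ hg hP hu).1 h.symm)
  · rw [if_pos ha, if_pos]
    exact (L.circleOf_stO_eq_of_inO _ hg hP ha).2 hu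

/-- **`pullU t` has the labels of `t` off the small circle.** [folklore] -/
theorem pullU_label_of_not_inO (t : K.EnhancedState)
    (ht : t.state L.f = true ∧ t.state L.g = true ∧ L.P t.state) {u : K.Arc} (hu : ¬ L.InO u) :
    (pullU t ht).label u = t.label u := by
  obtain ⟨hf, hg, hP⟩ := cond_of_stU ht
  set σ := Function.update (Function.update t.state L.g false) L.f false
  have hst : t.state = L.stU σ := (L.stU_update_false ht.1 ht.2.1).symm
  show ((L.isMergeAt σ hg hP).pull _ _ _).label u = _
  rw [IsMergeAt.pull_label]
  simp only [EnhancedState.lab_val]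
  have lab : ∀ w : K.Arc, K.circleOf (L.stO σ) u = K.circleOf (L.stO σ) w → (w = L.aG ∨ w = L.bG) →
      t.label L.aG = t.label u := by
    intro w hw hw'
    apply t.label_eq_of_circleOf_eq
    rw [hst]
    have h1 := L.circleOf_stU_eq_of_stO_eq σ hg hP hw
    rcases hw' with rfl | rfl
    · exact h1.symm
    · rw [h1, ← L.circleOf_stU_aG_eq_bG σ hg hP]
  rcases L.inO_aG_bG' with ⟨ha, hb⟩ | ⟨ha, hb⟩
  · rw [if_neg ha, if_neg ha]
    split_ifs with h1 h2
    · exact lab _ h1 (Or.inl rfl)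
    · exact (hu ((L.circleOf_stO_eq_of_inO σ hg hP hb).1 h2)).elim
    · rfl
  · rw [if_pos ha, if_pos ha]
    split_ifs with h1 h2
    · exact (hu ((L.circleOf_stO_eq_of_inO σ hg hP ha).1 h1)).elim
    · exact lab _ h2 (Or.inr rfl)
    · rfl

/-- The sector conditions of `pullU t`. [folklore] -/
theorem pullU_cond (t : K.EnhancedState) (ht : t.state L.f = true ∧ t.state L.g = true ∧ L.P t.state) :
    (pullU t ht).state L.f = true ∧ (pullU t ht).state L.g = false ∧ L.P (pullU t ht).state := by
  obtain ⟨-, hg, hP⟩ := cond_of_stU ht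
  rw [pullU_state]
  exact ⟨L.stO_f _, by rw [stO_g]; exact hg, (L.P_stO _).2 hP⟩

/-- **Round trip through the sector `U`**: `embU (pullA (pullU t)) = t`. [folklore] -/
theorem embU_pullA_pullU (t : K.EnhancedState) (ht : t.state L.f = true ∧ t.state L.g = true ∧ L.P t.state) :
    embU (pullA (pullU t ht) (pullU_cond t ht)) = t := by
  obtain ⟨hf, hg, hP⟩ := cond_of_stU ht
  have hst : t.state = L.stU (Function.update (Function.update t.state L.g false) L.f false) :=
    (L.stU_update_false ht.1 ht.2.1).symm
  have hxs : (pullA (pullU t ht) (pullU_cond t ht)).1.state =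
      Function.update (Function.update t.state L.g false) L.f false := by
    rw [pullA_state, pullU_state]
    unfold stO
    rw [Function.update_idem]
    exact Function.update_eq_self_iff.2 hf.symm
  refine EnhancedState.ext' (by rw [embU_state, hxs, ← hst]) (funext fun u ↦ ?_)
  by_cases hu : L.InO u
  · rw [embU_label_of_inO _ hu, pullA_label_of_not_inO _ _ L.not_inO_cG,
      pullU_label_of_not_inO _ _ L.not_inO_cG]
    apply t.label_eq_of_circleOf_eq
    rw [hst, L.circleOf_stU_cG _ hg hP]
    exact (L.circleOf_stU_eq_aG_of_inO _ hg hP hu).symm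
  · rw [embU_label_of_not_inO _ hu, pullA_label_of_not_inO _ _ hu, pullU_label_of_not_inO _ _ hu]


/-- The sector conditions of `embU x`. [folklore] -/
theorem embU_cond (x : L.XA) :
    (embU x).state L.f = true ∧ (embU x).state L.g = true ∧ L.P (embU x).state := by
  rw [embU_state]
  exact ⟨L.stU_f _, L.stU_g _, (L.P_stU _).2 x.2.2.2⟩

/-! ## The adapted basis -/

variable (L)

/-- **The basis adapted to the cancellation**: the map from `A ⊕ P ⊕ Q ⊕ U ⊕ R` to the enhanced
states. Khovanov (2000), §5.3; Bar-Natan (2002), §4.3. [cite: Khovanov2000, §5.3] -/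
def embSum : L.XA ⊕ (L.XA ⊕ (L.XA ⊕ (L.XA ⊕ L.XR))) → K.EnhancedState :=
  Sum.elim (fun x ↦ x.1) (Sum.elim (fun x ↦ embO x true) (Sum.elim (fun x ↦ embO x false)
    (Sum.elim embU (fun r ↦ r.1))))

/-- `embSum` on the sector `A`. [folklore] -/
@[simp] theorem embSum_inl (x : L.XA) : L.embSum (.inl x) = x.1 := rfl
/-- `embSum` on the sector `P`. [folklore] -/
@[simp] theorem embSum_inr_inl (x : L.XA) : L.embSum (.inr (.inl x)) = embO x true := rfl
/-- `embSum` on the sector `Q`. [folklore] -/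
@[simp] theorem embSum_inr_inr_inl (x : L.XA) : L.embSum (.inr (.inr (.inl x))) = embO x false := rfl
/-- `embSum` on the sector `U`. [folklore] -/
@[simp] theorem embSum_inr_inr_inr_inl (x : L.XA) : L.embSum (.inr (.inr (.inr (.inl x)))) = embU x := rfl
/-- `embSum` on the rest. [folklore] -/
@[simp] theorem embSum_inr_inr_inr_inr (r : L.XR) : L.embSum (.inr (.inr (.inr (.inr r)))) = r.1 := rfl

include ho₀ in
/-- `embSum` is injective. [folklore] -/
theorem embSum_injective : Injective L.embSum := by
  have hA : ∀ x : L.XA, x.1.state L.f = false := fun x ↦ x.2.1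
  have hO : ∀ (x : L.XA) (o : Bool), (embO x o).state L.f = true ∧ (embO x o).state L.g = false :=
    fun x o ↦ ⟨(embO_cond x o).1, (embO_cond x o).2.1⟩
  have hU : ∀ x : L.XA, (embU x).state L.f = true ∧ (embU x).state L.g = true :=
    fun x ↦ ⟨(embU_cond x).1, (embU_cond x).2.1⟩
  have hR : ∀ r : L.XR, ¬ (L.P r.1.state ∧ (r.1.state L.f = false → r.1.state L.g = false)) := fun r ↦ r.2
  have hRA : ∀ (r : L.XR) (x : L.XA), r.1 ≠ x.1 := fun r x h ↦
    hR r (by rw [h]; exact ⟨x.2.2.2, fun _ ↦ x.2.2.1⟩)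
  have hRO : ∀ (r : L.XR) (x : L.XA) (o : Bool), r.1 ≠ embO x o := fun r x o h ↦
    hR r (by rw [h]; exact ⟨(embO_cond x o).2.2, fun _ ↦ (embO_cond x o).2.1⟩)
  have hRU : ∀ (r : L.XR) (x : L.XA), r.1 ≠ embU x := fun r x h ↦
    hR r (by rw [h]; refine ⟨(embU_cond x).2.2, fun h' ↦ ?_⟩; rw [(embU_cond x).1] at h'
             exact Bool.noConfusion h')
  have hAO : ∀ (x y : L.XA) (o : Bool), x.1 ≠ embO y o := fun x y o h ↦ by
    have := hA x; rw [h, (hO y o).1] at this; exact Bool.noConfusion this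
  have hAU : ∀ (x y : L.XA), x.1 ≠ embU y := fun x y h ↦ by
    have := hA x; rw [h, (hU y).1] at this; exact Bool.noConfusion this
  have hOU : ∀ (x y : L.XA) (o : Bool), embO x o ≠ embU y := fun x y o h ↦ by
    have := (hO x o).2; rw [h, (hU y).2] at this; exact Bool.noConfusion this
  have hPQ : ∀ (x y : L.XA), embO x true ≠ embO y false := fun x y h ↦ by
    have := embO_label_of_inO x true ho₀
    rw [h, embO_label_of_inO y false ho₀] at this
    exact Bool.noConfusion this
  intro a b h
  rcases a with x | x | x | x | r <;> rcases b with y | y | y | y | r' <;>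
    simp only [embSum_inl, embSum_inr_inl, embSum_inr_inr_inl, embSum_inr_inr_inr_inl,
      embSum_inr_inr_inr_inr] at h
  · exact congrArg Sum.inl (Subtype.ext h)
  · exact (hAO x y true h).elim
  · exact (hAO x y false h).elim
  · exact (hAU x y h).elim
  · exact (hRA r' x h.symm).elim
  · exact (hAO y x true h.symm).elim
  · exact congrArg (fun y ↦ Sum.inr (Sum.inl y)) (embO_injective true h)
  · exact (hPQ x y h).elim
  · exact (hOU x y true h).elim
  · exact (hRO r' x true h.symm).elim
  · exact (hAO y x false h.symm).elim
  · exact (hPQ y x h.symm).elim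
  · exact congrArg (fun y ↦ Sum.inr (Sum.inr (Sum.inl y))) (embO_injective false h)
  · exact (hOU x y false h).elim
  · exact (hRO r' x false h.symm).elim
  · exact (hAU y x h.symm).elim
  · exact (hOU y x true h.symm).elim
  · exact (hOU y x false h.symm).elim
  · exact congrArg (fun y ↦ Sum.inr (Sum.inr (Sum.inr (Sum.inl y)))) (embU_injective h)
  · exact (hRU r' x h.symm).elim
  · exact (hRA r y h).elim
  · exact (hRO r y true h).elim
  · exact (hRO r y false h).elim
  · exact (hRU r y h).elim
  · exact congrArg (fun y ↦ Sum.inr (Sum.inr (Sum.inr (Sum.inr y)))) (Subtype.ext h)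

include ho₀ in
/-- `embSum` is surjective: **every enhanced state lies in one of the five sectors.** [folklore] -/
theorem embSum_surjective : Surjective L.embSum := by
  intro t
  by_cases hP : L.P t.state
  · cases hf : t.state L.f <;> cases hg : t.state L.g
    · exact ⟨.inl ⟨t, hf, hg, hP⟩, rfl⟩
    · exact ⟨.inr (.inr (.inr (.inr ⟨t, fun h ↦ by
        have h' := h.2 hf; rw [hg] at h'; exact Bool.noConfusion h'⟩))), rfl⟩
    · have key := embO_pullA o₀ ho₀ t ⟨hf, hg, hP⟩
      cases ho : t.label o₀
      · refine ⟨.inr (.inr (.inl (pullA t ⟨hf, hg, hP⟩))), ?_⟩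
        rw [ho] at key
        exact key
      · refine ⟨.inr (.inl (pullA t ⟨hf, hg, hP⟩)), ?_⟩
        rw [ho] at key
        exact key
    · exact ⟨.inr (.inr (.inr (.inl (pullA (pullU t ⟨hf, hg, hP⟩) (pullU_cond t ⟨hf, hg, hP⟩))))),
        embU_pullA_pullU t ⟨hf, hg, hP⟩⟩
  · exact ⟨.inr (.inr (.inr (.inr ⟨t, fun h ↦ hP h.1⟩))), rfl⟩

/-- **The bijection of the five sectors with the enhanced states.** Khovanov (2000), §5.3;
Bar-Natan (2002), §4.3. [cite: Khovanov2000, §5.3] -/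
def loopESEquiv : L.XA ⊕ (L.XA ⊕ (L.XA ⊕ (L.XA ⊕ L.XR))) ≃ K.EnhancedState :=
  Equiv.ofBijective L.embSum ⟨L.embSum_injective o₀ ho₀, L.embSum_surjective o₀ ho₀⟩

/-- `loopESEquiv` is `embSum`. [folklore] -/
@[simp] theorem loopESEquiv_apply (a : L.XA ⊕ (L.XA ⊕ (L.XA ⊕ (L.XA ⊕ L.XR)))) :
    L.loopESEquiv o₀ ho₀ a = L.embSum a := rfl

/-! ## The blocks of the differential -/

variable {L}

section Ring

variable {R : Type} [CommRing R] (hR tR : R)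

include ho₀ in
/-- Other chords never change the label of the small circle: **an incidence number between two
states over loop resolutions that label the small circle differently vanishes** (the block
`Q → P`). Khovanov (2000), §5.3. [cite: Khovanov2000, §5.3] -/
theorem incidence_eq_zero_of_label_O_ne {t t' : K.EnhancedState}
    (ht : t.state L.f = true ∧ t.state L.g = false ∧ L.P t.state)
    (ht' : t'.state L.f = true ∧ t'.state L.g = false ∧ L.P t'.state)
    (hl : t.label o₀ ≠ t'.label o₀) : K.incidence R hR tR t t' = 0 := by
  by_contra hne
  obtain ⟨j, hj, hs⟩ := exists_of_incidence_ne_zero hne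
  have hjg : j ≠ L.g := by
    rintro rfl
    have h1 := congrFun hs L.g
    rw [Function.update_self, ht'.2.1] at h1
    exact Bool.noConfusion h1
  have hjf : j ≠ L.f := by
    rintro rfl
    rw [ht.1] at hj
    exact Bool.noConfusion hj
  have hjO : ¬ L.InO (K.arcIn (K.overPos j)) :=
    L.not_inO_arcIn t.state j ht.2.2 (by rw [← hs]; exact ht'.2.2) hj hjf hjg
  -- in both states the small circle is off the circle of the first strand of `j`
  have hoff : ∀ s : K.EnhancedState, s.state L.f = true ∧ s.state L.g = false ∧ L.P s.state →
      K.circleOf s.state o₀ ≠ K.circleOf s.state (K.arcIn (K.overPos j)) := by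
    intro s hs' h
    have e := (stO_of_state hs'.1).symm
    rw [e] at h
    exact hjO ((L.circleOf_stO_eq_of_inO _ (by rw [Function.update_of_ne L.f_ne_g.symm]; exact hs'.2.1)
      ((L.P_update_f _ _).2 hs'.2.2) ho₀).1 h.symm)
  rw [K.incidence_of_flip R hR tR hj hs] at hne
  by_cases hm : K.IsMergeAt t.state j
  · rw [if_pos hm] at hne
    by_cases hc : ∀ c, K.circleOf t'.state c ≠ K.circleOf t'.state (K.arcIn (K.overPos j)) →
        t'.label c = t.label c
    · exact hl (hc _ (hoff t' ht')).symm
    · rw [if_neg hc] at hne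
      exact hne rfl
  · rw [if_neg hm] at hne
    by_cases hsp : K.IsSplitAt t.state j
    · rw [if_pos hsp] at hne
      by_cases hc : ∀ c, K.circleOf t.state c ≠ K.circleOf t.state (K.arcIn (K.overPos j)) →
          t'.label c = t.label c
      · exact hl (hc _ (hoff t ht)).symm
      · rw [if_neg hc] at hne
        exact hne rfl
    · rw [if_neg hsp] at hne
      exact hne rfl

/-- **The block `A → P` is the identity up to the Koszul sign.** Khovanov (2000), §5.3, (5);
Bar-Natan (2002), §4.3. [cite: Khovanov2000, §5.3] -/
theorem incidence_embA_embP (x x' : L.XA) :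
    K.incidence R hR tR x.1 (embO x' true) = if x = x' then (edgeSign x.1.state L.f : R) else 0 := by
  by_cases hss : x.1.state = x'.1.state
  · have key := (L.isSplitAt x'.1.state x'.2.1 x'.2.2.1 x'.2.2.2).incidence_push' hR tR x.1 hss
      (x'.1.lab rfl) (if L.InO L.aF then true else x'.1.label L.aF) (if L.InO L.aF then x'.1.label L.aF else true)
    change K.incidence R hR tR x.1 (embO x' true) = _ at key
    rw [key]
    simp only [EnhancedState.lab_val]
    change (if ∀ u, K.circleOf x'.1.state u ≠ K.circleOf x'.1.state L.aF → x'.1.label u = x.1.label u then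
      (edgeSign x'.1.state L.f : R) *
        splitCoeff R hR tR (x.1.label L.aF) (if L.InO L.aF then true else x'.1.label L.aF)
          (if L.InO L.aF then x'.1.label L.aF else true) else 0) = _
    have tab : splitCoeff R hR tR (x.1.label L.aF) (if L.InO L.aF then true else x'.1.label L.aF)
        (if L.InO L.aF then x'.1.label L.aF else true) =
        if x'.1.label L.aF = x.1.label L.aF then 1 else 0 := by
      rw [← splitCoeff_o_true hR tR (x.1.label L.aF) (x'.1.label L.aF) (decide (L.InO L.aF))]
      by_cases h : L.InO L.aF <;> simp [h]
    rw [tab, hss]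
    by_cases hxx : x = x'
    · subst hxx
      rw [if_pos (fun u _ ↦ rfl), if_pos rfl, if_pos rfl, mul_one]
    · rw [if_neg hxx]
      split_ifs with hC hℓ
      · exfalso
        apply hxx
        apply Subtype.ext
        refine EnhancedState.ext' hss (funext fun u ↦ ?_)
        by_cases hu : K.circleOf x'.1.state u = K.circleOf x'.1.state L.aF
        · have hu1 : K.circleOf x.1.state u = K.circleOf x.1.state L.aF := by rw [hss]; exact hu
          rw [x.1.label_eq_of_circleOf_eq hu1, x'.1.label_eq_of_circleOf_eq hu, hℓ]
        · exact (hC u hu).symm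
      · rw [mul_zero]
      · rfl
  · rw [if_neg (fun h ↦ hss (by rw [h]))]
    apply K.incidence_of_not_flip R hR tR
    rintro ⟨j, -, hs⟩
    apply hss
    rw [embO_state] at hs
    have h1 : j = L.f := by
      by_contra hne
      have := congrFun hs L.f
      rw [Function.update_of_ne (fun h ↦ hne h.symm), stO_f, x.2.1] at this
      exact Bool.noConfusion this
    subst h1
    exact L.eq_of_stO_eq hs.symm (by rw [x.2.1, x'.2.1])

/-- The labels of `embO x o` at the two local strands of `g`. [folklore] -/
theorem embO_label_aG_bG (x : L.XA) (o : Bool) :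
    ((embO x o).label L.aG, (embO x o).label L.bG) =
      if L.InO L.aG then (o, x.1.label L.cG) else (x.1.label L.cG, o) := by
  unfold cG
  rcases L.inO_aG_bG' with ⟨ha, hb⟩ | ⟨ha, hb⟩
  · rw [if_neg ha, if_neg ha, embO_label_of_not_inO x o ha, embO_label_of_inO x o hb]
  · rw [if_pos ha, if_pos ha, embO_label_of_inO x o ha, embO_label_of_not_inO x o hb]

/-- **The block `Q → U` is the identity up to the Koszul sign.** Khovanov (2000), §5.3, (4);
Bar-Natan (2002), §4.3. [cite: Khovanov2000, §5.3] -/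
theorem incidence_embQ_embU (x x' : L.XA) :
    K.incidence R hR tR (embO x false) (embU x') =
      if x = x' then (edgeSign (L.stO x.1.state) L.g : R) else 0 := by
  by_cases hss : x.1.state = x'.1.state
  · have hx : (embO x false).state = L.stO x'.1.state := by rw [← hss]; exact embO_state x false
    have key := (L.isMergeAt x'.1.state x'.2.2.1 x'.2.2.2).incidence_push' hR tR
      (embO x false) hx ((embO x' false).lab (embO_state x' false)) (x'.1.label L.cG)
    change K.incidence R hR tR (embO x false) (embU x') = _ at key
    rw [update_stO_g] at key
    rw [key]
    simp only [EnhancedState.lab_val]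
    change (if ∀ u, K.circleOf (L.stU x'.1.state) u ≠ K.circleOf (L.stU x'.1.state) L.aG →
        (embO x' false).label u = (embO x false).label u then
      (edgeSign (L.stO x'.1.state) L.g : R) *
        mergeCoeff R hR tR ((embO x false).label L.aG) ((embO x false).label L.bG) (x'.1.label L.cG) else 0) = _
    have tab : mergeCoeff R hR tR ((embO x false).label L.aG) ((embO x false).label L.bG) (x'.1.label L.cG) =
        if x'.1.label L.cG = x.1.label L.cG then 1 else 0 := by
      have hab := embO_label_aG_bG x false
      rw [← mergeCoeff_o_false hR tR (x.1.label L.cG) (x'.1.label L.cG) (decide (L.InO L.aG))]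
      by_cases h : L.InO L.aG
      · rw [if_pos h] at hab
        simp only [Prod.mk.injEq] at hab
        rw [hab.1, hab.2]
        simp [h]
      · rw [if_neg h] at hab
        simp only [Prod.mk.injEq] at hab
        rw [hab.1, hab.2]
        simp [h]
    rw [tab, hss]
    by_cases hxx : x = x'
    · subst hxx
      rw [if_pos (fun u _ ↦ rfl), if_pos rfl, if_pos rfl, mul_one]
    · rw [if_neg hxx]
      split_ifs with hC hℓ
      · exfalso
        apply hxx
        apply Subtype.ext
        refine EnhancedState.ext' hss (funext fun u ↦ ?_)
        by_cases hu : L.InO u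
        · have e1 : x.1.label u = x.1.label L.cF := x.1.label_eq_of_circleOf_eq (by
            rw [L.circleOf_stA_cF _ x.2.1 x.2.2.1 x.2.2.2]
            exact L.circleOf_stA_eq_aF_of_inO _ x.2.1 x.2.2.1 x.2.2.2 hu)
          have e2 : x'.1.label u = x'.1.label L.cF := x'.1.label_eq_of_circleOf_eq (by
            rw [L.circleOf_stA_cF _ x'.2.1 x'.2.2.1 x'.2.2.2]
            exact L.circleOf_stA_eq_aF_of_inO _ x'.2.1 x'.2.2.1 x'.2.2.2 hu)
          rw [e1, e2]
          by_cases hc : K.circleOf (L.stU x'.1.state) L.cF = K.circleOf (L.stU x'.1.state) L.aG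
          · have r1 : ∀ y : L.XA, y.1.state = x'.1.state → y.1.label L.cF = y.1.label L.cG := by
              intro y hy
              rw [← embU_label_of_not_inO y L.not_inO_cF, embU_label, if_pos]
              rw [hy]; exact hc
            rw [r1 x hss, r1 x' rfl, hℓ]
          · have := hC _ hc
            rwa [embO_label_of_not_inO x' false L.not_inO_cF, embO_label_of_not_inO x false L.not_inO_cF,
              eq_comm] at this
        · by_cases hc : K.circleOf (L.stU x'.1.state) u = K.circleOf (L.stU x'.1.state) L.aG
          · have r1 : ∀ y : L.XA, y.1.state = x'.1.state → y.1.label u = y.1.label L.cG := by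
              intro y hy
              rw [← embU_label_of_not_inO y hu, embU_label, if_pos]
              rw [hy]; exact hc
            rw [r1 x hss, r1 x' rfl, hℓ]
          · have := hC _ hc
            rwa [embO_label_of_not_inO x' false hu, embO_label_of_not_inO x false hu, eq_comm] at this
      · rw [mul_zero]
      · rfl
  · rw [if_neg (fun h ↦ hss (by rw [h]))]
    apply K.incidence_of_not_flip R hR tR
    rintro ⟨j, -, hs⟩
    apply hss
    rw [embU_state, embO_state] at hs
    have h1 : j = L.g := by
      by_contra hne
      have := congrFun hs L.g
      rw [Function.update_of_ne (fun h ↦ hne h.symm), stU_g, stO_g, x.2.2.1] at this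
      exact Bool.noConfusion this
    subst h1
    rw [update_stO_g] at hs
    exact L.eq_of_stU_eq hs.symm (by rw [x.2.1, x'.2.1]) (by rw [x.2.2.1, x'.2.2.1])

/-- The block `A → P` has nonzero diagonal (over `ℤ`). [folklore] -/
theorem incidence_embA_embP_self_ne_zero (x : L.XA) : K.incidence ℤ 0 0 x.1 (embO x true) ≠ 0 := by
  rw [incidence_embA_embP, if_pos rfl]
  unfold edgeSign
  simp

/-- The block `Q → U` has nonzero diagonal (over `ℤ`). [folklore] -/
theorem incidence_embQ_embU_self_ne_zero (x : L.XA) : K.incidence ℤ 0 0 (embO x false) (embU x) ≠ 0 := by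
  rw [incidence_embQ_embU, if_pos rfl]
  unfold edgeSign
  simp

end Ring

end LoopSq

end GaussDiagram

end Literature.Topology.FourManifolds
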